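import Mathlib
import Summits.MatrixMultiplication.MatrixMultiplication.Theorems.SnSubsetDichotomyPolynomialSlackMarginals
import Summits.MatrixMultiplication.MatrixMultiplication.Theorems.SnSubsetDichotomyPolynomialSlackCylinderMarginals
import Summits.MatrixMultiplication.MatrixMultiplication.Theorems.SnSubsetDichotomyPolynomialSlackPermBernstein

/-!
# The cost of flat pull-backs: a unique-quotient pair cannot anti-align its point pull-backs cheaply

Crux `Summit.MatrixMultiplication.MatrixMultiplication.Theses.SnSubsetDichotomy.PolynomialSlack`
(item `stmt-MatrixMultiplication-8306`), level-one programme, lead c3 (crux notes §C.2). Let `S, T ⊆ S_n` have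
unique quotients (`(s,t) ↦ s⁻¹t` injective on `S × T`, e.g. two members of a TPP triple), fix a value `i₀`, and
let `d_S(p) = #{s : s p = i₀}/|S|`, `d_T(w) = #{t : t w = i₀}/|T|` be the laws of the pull-backs `s⁻¹i₀`, `t⁻¹i₀`.
The statistic `Y(g) = n·Σ_w d_T(w)·d_S(g w) ≥ 0` has mean `1` over `S_n` and mean
`n·P/(|S|²|T|²)` over the quotient set `S⁻¹T`, `P = Σ_{p,w} m_{ST}(p,w)·c_S(i₀,p)·c_T(i₀,w)`. If that mean is
small, `n·P ≤ β·|S|²|T|²` with `β ≤ 9/64`, then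

  `|S|·|T| ≤ 4·n!·exp(-1/(1250·(1 + log n)·β))`                (`quotient_cost`),

i.e. `K = n!/|S⁻¹T| ≥ ¼·e^{Ω(1/((1+log n)β))}`. Proof: `‖d_S‖²‖d_T‖² ≤ P/(|S|²|T|²) ≤ β/n`; truncate each law at
`θ = 4‖d‖²` (mass lost `≤ 1/4` by Markov), so the truncated statistic `Y♭ ≤ Y` is a permuted sum with entries
`≤ 16·n·‖d_S‖²‖d_T‖² ≤ 16β`, squared-entry budget `≤ β` and mean `μ ≥ 9/16`; the tree's Bernstein inequality
`card_permutedSum_tail_le` bounds `#{Y♭ ≤ μ/2}` by `2n!·e^{-1/(1250(1+log n)β)}`, while by Markov on `S⁻¹T`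
at least half of the `|S||T|` quotients have `Y♭ ≤ μ/2`. With the pinned cylinder formula
(`cylinder_pullback_pinned`: `β = (n-1)η' + n!/(2N) + n!^{3/2}/(2N√D)`), this prices a point-cylinder member of
a TPP triple at `K_{S⁻¹T} ≥ e^{Ω(n/F)}` up to the inner energy of the member — see the follow-up file.
-/

namespace Summit.MatrixMultiplication.MatrixMultiplication.Theorems.PolynomialSlack

open scoped BigOperators

set_option linter.dupNamespace false

variable {n : ℕ}

/-- Sums over the quotient pairs against a function of one coordinate: `Σ_{(x,y)} φ((x⁻¹y) w) = Σ_p φ(p)·m_{XY}(p,w)`.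
[folklore] -/
theorem sum_quot_apply_eq (X Y : Finset (Equiv.Perm (Fin n))) (w : Fin n) (φ : Fin n → ℝ) :
    ∑ xy ∈ X ×ˢ Y, φ ((xy.1⁻¹ * xy.2) w) =
      ∑ p : Fin n, φ p * (((X ×ˢ Y).filter fun xy => xy.2 w = xy.1 p).card : ℝ) := by
  have h : ∀ xy : Equiv.Perm (Fin n) × Equiv.Perm (Fin n), φ ((xy.1⁻¹ * xy.2) w) =
      ∑ p : Fin n, if (xy.1⁻¹ * xy.2) w = p then φ p else 0 := fun xy => by
    rw [Finset.sum_ite_eq Finset.univ ((xy.1⁻¹ * xy.2) w) φ]; simp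
  simp_rw [h]
  rw [Finset.sum_comm]
  refine Finset.sum_congr rfl fun p _ => ?_
  have h2 : ∀ xy : Equiv.Perm (Fin n) × Equiv.Perm (Fin n),
      (if (xy.1⁻¹ * xy.2) w = p then φ p else 0) = φ p * (if (xy.1⁻¹ * xy.2) w = p then (1 : ℕ) else 0 : ℕ) :=
    fun xy => by split_ifs <;> simp
  simp_rw [h2]
  rw [← Finset.mul_sum, ← Nat.cast_sum, sum_ite_quot_apply X Y p w]

/-- Markov for a truncation: the mass of a nonnegative vector above the level `θ > 0` is at most `Σ d²/θ`.
[folklore] -/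
theorem sum_filter_lt_le_sum_sq_div (d : Fin n → ℝ) (hd : ∀ p, 0 ≤ d p) (θ : ℝ) (hθ : 0 < θ) :
    ∑ p ∈ Finset.univ.filter (fun p => θ < d p), d p ≤ (∑ p : Fin n, d p ^ 2) / θ := by
  rw [le_div_iff₀ hθ, Finset.sum_mul]
  calc ∑ p ∈ Finset.univ.filter (fun p => θ < d p), d p * θ
      ≤ ∑ p ∈ Finset.univ.filter (fun p => θ < d p), d p ^ 2 :=
        Finset.sum_le_sum fun p hp => by
          have h := (Finset.mem_filter.1 hp).2
          rw [sq]; exact mul_le_mul_of_nonneg_left h.le (hd p)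
    _ ≤ ∑ p : Fin n, d p ^ 2 :=
        Finset.sum_le_sum_of_subset_of_nonneg (Finset.filter_subset _ _) fun p _ _ => sq_nonneg _

set_option maxHeartbeats 1600000 in
/-- **The cost of flat pull-backs.** Let `n ≥ 1`, let `S, T ⊆ S_n` be non-empty with `(s,t) ↦ s⁻¹t`
injective on `S × T`, let `i₀ : Fin n`, and suppose
`n·Σ_{p,w} m_{ST}(p,w)·c_S(i₀,p)·c_T(i₀,w) ≤ β·(|S||T|)²` with `0 < β ≤ 9/64`. Then
`|S|·|T| ≤ 4·n!·exp(-1/(1250·(1 + log n)·β))`. [folklore] -/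
theorem quotient_cost (hn : 1 ≤ n) (S T : Finset (Equiv.Perm (Fin n))) (hS : S.Nonempty) (hT : T.Nonempty)
    (hinj : Set.InjOn (fun x : Equiv.Perm (Fin n) × Equiv.Perm (Fin n) => x.1⁻¹ * x.2)
      (↑S ×ˢ ↑T : Set (Equiv.Perm (Fin n) × Equiv.Perm (Fin n))))
    (i₀ : Fin n) (β : ℝ) (hβ0 : 0 < β) (hβ : β ≤ 9 / 64)
    (hP : (n : ℝ) * ∑ p : Fin n, ∑ w : Fin n, (((S ×ˢ T).filter fun st => st.2 w = st.1 p).card : ℝ) *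
        ((S.filter fun s => s p = i₀).card : ℝ) * ((T.filter fun t => t w = i₀).card : ℝ) ≤
      β * ((S.card : ℝ) * T.card) ^ 2) :
    (S.card : ℝ) * T.card ≤ 4 * n.factorial * Real.exp (-(1 / (1250 * (1 + Real.log n) * β))) := by
  classical
  -- notation
  set sR : ℝ := (S.card : ℝ) with hsR
  set tR : ℝ := (T.card : ℝ) with htR
  have hsR0 : 0 < sR := by rw [hsR]; exact_mod_cast hS.card_pos
  have htR0 : 0 < tR := by rw [htR]; exact_mod_cast hT.card_pos
  have hnR : (1 : ℝ) ≤ n := by exact_mod_cast hn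
  have hn0 : (0 : ℝ) < n := by linarith
  set a : Fin n → Fin n → ℝ := fun p w => (((S ×ˢ T).filter fun st => st.2 w = st.1 p).card : ℝ) with ha
  set cS : Fin n → ℝ := fun p => ((S.filter fun s => s p = i₀).card : ℝ) with hcS
  set cT : Fin n → ℝ := fun w => ((T.filter fun t => t w = i₀).card : ℝ) with hcT
  set dS : Fin n → ℝ := fun p => cS p / sR with hdS
  set dT : Fin n → ℝ := fun w => cT w / tR with hdT
  have hdS0 : ∀ p, 0 ≤ dS p := fun p => div_nonneg (Nat.cast_nonneg _) hsR0.le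
  have hdT0 : ∀ w, 0 ≤ dT w := fun w => div_nonneg (Nat.cast_nonneg _) htR0.le
  have hdSsum : ∑ p, dS p = 1 := by
    simp only [hdS]; rw [← Finset.sum_div, hcS, sum_marginal_row S i₀, ← hsR, div_self hsR0.ne']
  have hdTsum : ∑ w, dT w = 1 := by
    simp only [hdT]; rw [← Finset.sum_div, hcT, sum_marginal_row T i₀, ← htR, div_self htR0.ne']
  set ES : ℝ := ∑ p, dS p ^ 2 with hES
  set ET : ℝ := ∑ w, dT w ^ 2 with hET
  -- `‖d_S‖² ≥ 1/n`, `‖d_T‖² ≥ 1/n` (Cauchy–Schwarz), in particular both are positive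
  have hCS : ∀ d : Fin n → ℝ, ∑ p, d p = 1 → 1 ≤ (n : ℝ) * ∑ p, d p ^ 2 := by
    intro d hd
    have h := Finset.sum_mul_sq_le_sq_mul_sq Finset.univ d (fun _ => (1 : ℝ))
    simp only [mul_one, one_pow, Finset.sum_const, Finset.card_univ, Fintype.card_fin, nsmul_eq_mul,
      hd] at h
    linarith
  have hES0 : 0 < ES := by
    have := hCS dS hdSsum; rw [← hES] at this
    nlinarith
  have hET0 : 0 < ET := by
    have := hCS dT hdTsum; rw [← hET] at this
    nlinarith
  -- `P ≥ |S|²|T|²·ES·ET`, hence `ES·ET ≤ β/n`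
  set P : ℝ := ∑ p, ∑ w, a p w * cS p * cT w with hPdef
  have hPge : sR ^ 2 * tR ^ 2 * (ES * ET) ≤ P := by
    have hterm : ∀ p w, cS p * cT w * cS p * cT w ≤ a p w * cS p * cT w := fun p w =>
      mul_le_mul_of_nonneg_right (mul_le_mul_of_nonneg_right
        (mul_marginal_le_pairMarginal S T p w i₀) (Nat.cast_nonneg _)) (Nat.cast_nonneg _)
    have hexp : sR ^ 2 * tR ^ 2 * (ES * ET) = ∑ p, ∑ w, cS p * cT w * cS p * cT w := by
      simp only [hES, hET, hdS, hdT]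
      rw [Finset.sum_mul_sum]
      simp_rw [Finset.mul_sum]
      refine Finset.sum_congr rfl fun p _ => Finset.sum_congr rfl fun w _ => ?_
      field_simp
    rw [hexp]
    exact Finset.sum_le_sum fun p _ => Finset.sum_le_sum fun w _ => hterm p w
  have hEE : ES * ET ≤ β / n := by
    rw [le_div_iff₀ hn0]
    have h1 : (n : ℝ) * (sR ^ 2 * tR ^ 2 * (ES * ET)) ≤ β * (sR * tR) ^ 2 := by
      calc (n : ℝ) * (sR ^ 2 * tR ^ 2 * (ES * ET)) ≤ n * P := mul_le_mul_of_nonneg_left hPge hn0.le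
        _ ≤ β * (sR * tR) ^ 2 := hP
    have h2 : 0 < sR ^ 2 * tR ^ 2 := mul_pos (pow_pos hsR0 2) (pow_pos htR0 2)
    nlinarith
  -- truncation
  set θS : ℝ := 4 * ES with hθS
  set θT : ℝ := 4 * ET with hθT
  set fS : Fin n → ℝ := fun p => if dS p ≤ θS then dS p else 0 with hfS
  set fT : Fin n → ℝ := fun w => if dT w ≤ θT then dT w else 0 with hfT
  have hfS0 : ∀ p, 0 ≤ fS p := fun p => by simp only [hfS]; split_ifs <;> [exact hdS0 p; exact le_rfl]
  have hfT0 : ∀ w, 0 ≤ fT w := fun w => by simp only [hfT]; split_ifs <;> [exact hdT0 w; exact le_rfl]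
  have hfSle : ∀ p, fS p ≤ dS p := fun p => by simp only [hfS]; split_ifs <;> [exact le_rfl; exact hdS0 p]
  have hfTle : ∀ w, fT w ≤ dT w := fun w => by simp only [hfT]; split_ifs <;> [exact le_rfl; exact hdT0 w]
  have hθS0 : 0 < θS := by rw [hθS]; linarith
  have hθT0 : 0 < θT := by rw [hθT]; linarith
  have hfSθ : ∀ p, fS p ≤ θS := fun p => by
    simp only [hfS]; split_ifs with h <;> [exact h; exact hθS0.le]
  have hfTθ : ∀ w, fT w ≤ θT := fun w => by
    simp only [hfT]; split_ifs with h <;> [exact h; exact hθT0.le]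
  -- the truncated masses are at least `3/4`
  have hmassS : 3 / 4 ≤ ∑ p, fS p := by
    have hsplit : ∑ p, dS p = ∑ p, fS p + ∑ p ∈ Finset.univ.filter (fun p => θS < dS p), dS p := by
      rw [← Finset.sum_filter_add_sum_filter_not Finset.univ (fun p => θS < dS p) dS, add_comm]
      congr 1
      rw [Finset.sum_filter]
      refine Finset.sum_congr rfl fun p _ => ?_
      simp only [hfS, not_lt]
    have htail := sum_filter_lt_le_sum_sq_div dS hdS0 θS hθS0
    rw [← hES, hθS] at htail
    have : (ES / (4 * ES)) = 1 / 4 := by field_simp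
    rw [this] at htail
    linarith [hdSsum]
  have hmassT : 3 / 4 ≤ ∑ w, fT w := by
    have hsplit : ∑ w, dT w = ∑ w, fT w + ∑ w ∈ Finset.univ.filter (fun w => θT < dT w), dT w := by
      rw [← Finset.sum_filter_add_sum_filter_not Finset.univ (fun w => θT < dT w) dT, add_comm]
      congr 1
      rw [Finset.sum_filter]
      refine Finset.sum_congr rfl fun w _ => ?_
      simp only [hfT, not_lt]
    have htail := sum_filter_lt_le_sum_sq_div dT hdT0 θT hθT0
    rw [← hET, hθT] at htail
    have : (ET / (4 * ET)) = 1 / 4 := by field_simp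
    rw [this] at htail
    linarith [hdTsum]
  have hmassS1 : ∑ p, fS p ≤ 1 := hdSsum ▸ Finset.sum_le_sum fun p _ => hfSle p
  have hmassT1 : ∑ w, fT w ≤ 1 := hdTsum ▸ Finset.sum_le_sum fun w _ => hfTle w
  -- the permuted-sum statistic `Y♭(π) = Σ_w b w (π w)`, `b w v = n·fT w·fS v`
  set b : Fin n → Fin n → ℝ := fun w v => n * fT w * fS v with hb
  set μ : ℝ := (∑ w, fT w) * (∑ p, fS p) with hμ
  have hμlo : 9 / 16 ≤ μ := by
    rw [hμ]; nlinarith [hmassS, hmassT]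
  have hμhi : μ ≤ 1 := by
    rw [hμ]
    have h0 : 0 ≤ ∑ w, fT w := Finset.sum_nonneg fun w _ => hfT0 w
    nlinarith [hmassS1, hmassT1, hmassS]
  have hmean : (∑ w, ∑ v, b w v) / n = μ := by
    simp only [hb, hμ]
    simp_rw [← Finset.mul_sum]
    rw [← Finset.sum_mul, ← Finset.mul_sum]
    field_simp
  have hbabs : ∀ w v, |b w v| ≤ 16 * β := by
    intro w v
    simp only [hb]
    rw [abs_of_nonneg (mul_nonneg (mul_nonneg hn0.le (hfT0 w)) (hfS0 v))]
    calc (n : ℝ) * fT w * fS v ≤ n * θT * θS :=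
          mul_le_mul (mul_le_mul_of_nonneg_left (hfTθ w) hn0.le) (hfSθ v) (hfS0 v)
            (mul_nonneg hn0.le hθT0.le)
      _ = 16 * (n * (ES * ET)) := by rw [hθS, hθT]; ring
      _ ≤ 16 * (n * (β / n)) :=
          mul_le_mul_of_nonneg_left (mul_le_mul_of_nonneg_left hEE hn0.le) (by norm_num)
      _ = 16 * β := by field_simp
  have hbsq : (∑ w, ∑ v, b w v ^ 2) / n ≤ β := by
    have h1 : ∑ w, ∑ v, b w v ^ 2 = n ^ 2 * ((∑ w, fT w ^ 2) * ∑ v, fS v ^ 2) := by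
      simp only [hb]
      rw [Finset.sum_mul_sum, Finset.mul_sum]
      refine Finset.sum_congr rfl fun w _ => ?_
      simp only [Finset.mul_sum]
      refine Finset.sum_congr rfl fun v _ => ?_
      ring
    have h2 : ∑ w, fT w ^ 2 ≤ ET :=
      Finset.sum_le_sum fun w _ => pow_le_pow_left₀ (hfT0 w) (hfTle w) 2
    have h3 : ∑ v, fS v ^ 2 ≤ ES :=
      Finset.sum_le_sum fun v _ => pow_le_pow_left₀ (hfS0 v) (hfSle v) 2
    rw [h1, div_le_iff₀ hn0]
    have h4 : (∑ w, fT w ^ 2) * ∑ v, fS v ^ 2 ≤ ET * ES :=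
      mul_le_mul h2 h3 (Finset.sum_nonneg fun _ _ => sq_nonneg _) hET0.le
    calc (n : ℝ) ^ 2 * ((∑ w, fT w ^ 2) * ∑ v, fS v ^ 2) ≤ n ^ 2 * (ET * ES) :=
          mul_le_mul_of_nonneg_left h4 (pow_nonneg hn0.le 2)
      _ = n * (n * (ES * ET)) := by ring
      _ ≤ n * (n * (β / n)) := mul_le_mul_of_nonneg_left (mul_le_mul_of_nonneg_left hEE hn0.le) hn0.le
      _ = β * n := by field_simp
  -- Bernstein: the lower tail `{Y♭ ≤ μ/2}` is small
  set t : ℝ := μ / 2 with ht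
  have ht0 : 0 < t := by rw [ht]; linarith
  have hBern := card_permutedSum_tail_le (n := n) (16 * β) b hbabs t ht0
  rw [hmean] at hBern
  set L : ℝ := 1 + Real.log n with hL
  have hL1 : 1 ≤ L := by rw [hL]; linarith [Real.log_nonneg hnR]
  have hden_le : 32 * (1 + Real.log n) * (∑ w, ∑ v, b w v ^ 2) / n + 8 * (16 * β) * t ≤ 96 * L * β := by
    have h1 : 32 * (1 + Real.log n) * (∑ w, ∑ v, b w v ^ 2) / n = 32 * L * ((∑ w, ∑ v, b w v ^ 2) / n) := by
      rw [hL]; ring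
    rw [h1]
    have h2 : 32 * L * ((∑ w, ∑ v, b w v ^ 2) / n) ≤ 32 * L * β :=
      mul_le_mul_of_nonneg_left hbsq (by linarith)
    have h3 : 8 * (16 * β) * t ≤ 64 * L * β := by
      rw [ht]; nlinarith [hμhi, hL1, hβ0]
    linarith
  have hden0 : 0 < 32 * (1 + Real.log n) * (∑ w, ∑ v, b w v ^ 2) / n + 8 * (16 * β) * t := by
    have h0 : 0 ≤ 32 * (1 + Real.log n) * (∑ w, ∑ v, b w v ^ 2) / n := by
      apply div_nonneg _ hn0.le
      have h01 : 0 ≤ ∑ w, ∑ v, b w v ^ 2 :=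
        Finset.sum_nonneg fun _ _ => Finset.sum_nonneg fun _ _ => sq_nonneg _
      have h02 : 0 ≤ 1 + Real.log n := by linarith [Real.log_nonneg hnR]
      exact mul_nonneg (mul_nonneg (by norm_num) h02) h01
    have h1 : 0 < 8 * (16 * β) * t := by nlinarith [hβ0, ht0]
    linarith
  have hexp_le : Real.exp (-(t ^ 2 / (32 * (1 + Real.log n) * (∑ w, ∑ v, b w v ^ 2) / n +
      8 * (16 * β) * t))) ≤ Real.exp (-(1 / (1250 * (1 + Real.log n) * β))) := by
    rw [Real.exp_le_exp, neg_le_neg_iff, ← hL]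
    have hc : 1 / (1250 * L * β) ≤ t ^ 2 / (96 * L * β) := by
      rw [div_le_div_iff₀ (mul_pos (mul_pos (by norm_num) (by linarith)) hβ0)
        (mul_pos (mul_pos (by norm_num) (by linarith)) hβ0)]
      have : (81 : ℝ) / 1024 ≤ t ^ 2 := by rw [ht]; nlinarith [hμlo]
      nlinarith [hL1, hβ0]
    exact hc.trans (div_le_div_of_nonneg_left (sq_nonneg _) hden0 hden_le)
  -- the pairs with small `Y♭(s⁻¹t)` are at least half of `S × T`
  set Yf : Equiv.Perm (Fin n) → ℝ := fun π => ∑ w, b w (π w) with hYf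
  set B := (S ×ˢ T).filter fun st => Yf (st.1⁻¹ * st.2) ≤ μ / 2 with hB
  have hsumY : ∑ st ∈ S ×ˢ T, Yf (st.1⁻¹ * st.2) ≤ β * (sR * tR) := by
    -- `Σ_{(s,t)} Y♭(s⁻¹t) ≤ Σ_{(s,t)} Y(s⁻¹t) = n·P/(|S||T|)`
    have h1 : ∑ st ∈ S ×ˢ T, Yf (st.1⁻¹ * st.2) =
        ∑ w, n * fT w * ∑ p, fS p * a p w := by
      simp only [hYf, hb]
      rw [Finset.sum_comm]
      refine Finset.sum_congr rfl fun w _ => ?_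
      rw [Finset.mul_sum]
      have := sum_quot_apply_eq S T w (fun v => n * fT w * fS v)
      rw [this]
      refine Finset.sum_congr rfl fun p _ => ?_
      simp only [ha]; ring
    have h2 : ∑ w, n * fT w * ∑ p, fS p * a p w ≤ ∑ w, n * dT w * ∑ p, dS p * a p w := by
      refine Finset.sum_le_sum fun w _ => ?_
      have ha0' : 0 ≤ ∑ p, fS p * a p w := Finset.sum_nonneg fun p _ => mul_nonneg (hfS0 p) (Nat.cast_nonneg _)
      have hin : ∑ p, fS p * a p w ≤ ∑ p, dS p * a p w :=
        Finset.sum_le_sum fun p _ => mul_le_mul_of_nonneg_right (hfSle p) (Nat.cast_nonneg _)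
      calc (n : ℝ) * fT w * ∑ p, fS p * a p w ≤ n * dT w * ∑ p, fS p * a p w :=
            mul_le_mul_of_nonneg_right (mul_le_mul_of_nonneg_left (hfTle w) hn0.le) ha0'
        _ ≤ n * dT w * ∑ p, dS p * a p w :=
            mul_le_mul_of_nonneg_left hin (mul_nonneg hn0.le (hdT0 w))
    have h3 : ∑ w, n * dT w * ∑ p, dS p * a p w = n * P / (sR * tR) := by
      have e : ∀ w p, (n : ℝ) * dT w * (dS p * a p w) = (n / (sR * tR)) * (a p w * cS p * cT w) := by
        intro w p
        simp only [hdS, hdT]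
        field_simp
      calc ∑ w, n * dT w * ∑ p, dS p * a p w = ∑ w, ∑ p, (n : ℝ) * dT w * (dS p * a p w) := by
            simp_rw [Finset.mul_sum]
        _ = ∑ w, ∑ p, (n / (sR * tR)) * (a p w * cS p * cT w) :=
            Finset.sum_congr rfl fun w _ => Finset.sum_congr rfl fun p _ => e w p
        _ = (n / (sR * tR)) * ∑ p, ∑ w, a p w * cS p * cT w := by
            rw [Finset.sum_comm, Finset.mul_sum]
            refine Finset.sum_congr rfl fun p _ => ?_
            rw [Finset.mul_sum]
        _ = n * P / (sR * tR) := by rw [← hPdef]; ring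
    rw [h1]
    refine h2.trans ?_
    rw [h3, div_le_iff₀ (mul_pos hsR0 htR0)]
    have : (n : ℝ) * P ≤ β * (sR * tR) ^ 2 := hP
    nlinarith
  have hBcard : sR * tR / 2 ≤ (B.card : ℝ) := by
    -- Markov on the complement
    set B' := (S ×ˢ T).filter fun st => ¬ (Yf (st.1⁻¹ * st.2) ≤ μ / 2) with hB'
    have hY0 : ∀ π, 0 ≤ Yf π := fun π => Finset.sum_nonneg fun w _ => by
      simp only [hb]; exact mul_nonneg (mul_nonneg hn0.le (hfT0 w)) (hfS0 (π w))
    have h1 : μ / 2 * (B'.card : ℝ) ≤ ∑ st ∈ S ×ˢ T, Yf (st.1⁻¹ * st.2) := by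
      rw [← Finset.sum_filter_add_sum_filter_not (S ×ˢ T) (fun st => Yf (st.1⁻¹ * st.2) ≤ μ / 2)]
      have hA : 0 ≤ ∑ st ∈ (S ×ˢ T).filter (fun st => Yf (st.1⁻¹ * st.2) ≤ μ / 2), Yf (st.1⁻¹ * st.2) :=
        Finset.sum_nonneg fun st _ => hY0 _
      have hB2 : μ / 2 * (B'.card : ℝ) ≤
          ∑ st ∈ (S ×ˢ T).filter (fun st => ¬ (Yf (st.1⁻¹ * st.2) ≤ μ / 2)), Yf (st.1⁻¹ * st.2) := by
        rw [← hB']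
        calc μ / 2 * (B'.card : ℝ) = ∑ _st ∈ B', μ / 2 := by rw [Finset.sum_const, nsmul_eq_mul, mul_comm]
          _ ≤ ∑ st ∈ B', Yf (st.1⁻¹ * st.2) :=
              Finset.sum_le_sum fun st hst => (not_le.1 (Finset.mem_filter.1 hst).2).le
      linarith
    have hcards : (B.card : ℝ) + B'.card = sR * tR := by
      have := Finset.card_filter_add_card_filter_not (s := S ×ˢ T)
        (fun st => Yf (st.1⁻¹ * st.2) ≤ μ / 2)
      rw [← hB, ← hB', Finset.card_product] at this
      rw [hsR, htR]; exact_mod_cast this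
    have h2 : μ / 2 * (B'.card : ℝ) ≤ β * (sR * tR) := h1.trans hsumY
    -- `|B'| ≤ 2β|S||T|/μ ≤ (32β/9)|S||T| ≤ |S||T|/2`
    have h3 : (B'.card : ℝ) ≤ sR * tR / 2 := by
      have hst0 : 0 < sR * tR := mul_pos hsR0 htR0
      nlinarith [hμlo, hβ, h2, hβ0]
    linarith
  -- `B` injects into the Bernstein tail set
  have hBle : (B.card : ℝ) ≤ ((Finset.univ.filter fun π : Equiv.Perm (Fin n) =>
      t ≤ |∑ w, b w (π w) - μ|).card : ℝ) := by
    have h := Finset.card_le_card_of_injOn (s := B)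
      (t := Finset.univ.filter fun π : Equiv.Perm (Fin n) => t ≤ |∑ w, b w (π w) - μ|)
      (fun st => st.1⁻¹ * st.2) ?_ ?_
    · exact_mod_cast h
    · intro st hst
      have hst' := Finset.mem_filter.1 (Finset.mem_coe.1 hst)
      rw [Finset.mem_coe, Finset.mem_filter]
      refine ⟨Finset.mem_univ _, ?_⟩
      have hle : Yf (st.1⁻¹ * st.2) ≤ μ / 2 := hst'.2
      simp only [hYf] at hle
      rw [ht, abs_sub_comm]
      have : μ / 2 ≤ μ - ∑ w, b w ((st.1⁻¹ * st.2) w) := by linarith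
      exact this.trans (le_abs_self _)
    · intro x hx y hy hxy
      have hx' := (Finset.mem_filter.1 (Finset.mem_coe.1 hx)).1
      have hy' := (Finset.mem_filter.1 (Finset.mem_coe.1 hy)).1
      exact hinj (by simpa using hx') (by simpa using hy') hxy
  -- assemble
  have hfin : sR * tR / 2 ≤ 2 * (n.factorial : ℝ) * Real.exp (-(1 / (1250 * (1 + Real.log n) * β))) :=
    hBcard.trans (hBle.trans (hBern.trans (mul_le_mul_of_nonneg_left hexp_le (by positivity))))
  linarith

end Summit.MatrixMultiplication.MatrixMultiplication.Theorems.PolynomialSlack
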